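import Summits.Langlands.Langlands.Theses.GaloisHullLift

/-!
# `TrivialHullDescent` (stmt-Langlands-28227) — proved outright

Proof twin of the support item `Summit.Langlands.Langlands.Theses.GaloisHullLift.TrivialHullDescent`
(route `GaloisHullLift`, decomp-langlands lens-4; base rung `[L:K] = 1` of the Galois-hull induction):
a semisimple relative `ℓ`-adic avatar `r : Γ_L → GL_n(ℚ̄_ℓ)` of a cuspidal `π` on `GL_n/K` along an
extension `L/K` of degree `[L:K] = 1` descends to an avatar of `π` over `K`.

Proof (folklore transport along the isomorphism `K ≅ L`):
* `[L:K] = 1` makes `algebraMap K L` bijective (`Module.Free.bijective_algebraMap_of_finrank_eq_one`);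
  its inverse is an algebra structure `L → K`, along which `K/L` is Galois of degree `1`
  (`IsGalois.of_algEquiv` applied to `L ≃ₐ[L] K`);
* `ρ := r|_{Γ_K}` along that structure (`FramedGaloisRep.restrictField`) is semisimple
  (`FramedGaloisRep.isSemisimple_restrictField`, Clifford);
* a place `v` of `K` lies under the place `w(v) := v ∩ 𝓞_L` of `L` (computed along `L → K`), and
  `w(v)` lies over `v` along `K → L` (the composite `𝓞_K → 𝓞_L → 𝓞_K` is the identity); `v ↦ w(v)` is
  injective, so the cofinite hypothesis at the places of `L` pulls back to the places of `K`
  (`Function.Injective.tendsto_cofinite`), and Flath's `hasSatakeParamAt_cofinite_holds` supplies a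
  Satake parameter at almost every `v`;
* all residue degrees are `1` in an extension of degree `1` (`Ideal.inertiaDeg_pos`,
  `Ideal.inertiaDeg_le_finrank`), so `α ↦ α^{f}` is the identity on both legs, and the tree's
  `hasFrobCharpolyAt_restrictField_arithFrobPolyOfSatake` (restriction `Γ_K → Γ_L` at `v ∣ w(v)`)
  turns the Frobenius data of `r` at `w(v)` into the Frobenius data of `ρ` at `v`.
decomp-langlands lens-5 g22 proof twin, 2026-08-31.
-/

set_option linter.dupNamespace false

open NumberField IsDedekindDomain Filter Polynomial

namespace Summit.Langlands.Langlands.Theorems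

namespace TrivialHullDescentProof

open Literature.NumberTheory.Automorphic Literature.NumberTheory.GaloisRepresentations

/-- In an extension of number fields of degree `[E:F] = 1` every residue degree is `1`
(`1 ≤ f(w|v) ≤ [E:F]`, `Ideal.inertiaDeg_pos`, `Ideal.inertiaDeg_le_finrank`). [folklore] -/
theorem inertiaDeg_eq_one_of_finrank_eq_one {F E : Type*} [Field F] [NumberField F] [Field E]
    [NumberField E] [Algebra F E] (h : Module.finrank F E = 1) (w : HeightOneSpectrum (𝓞 E)) :
    w.asIdeal.inertiaDeg (𝓞 F) = 1 := by
  haveI : NoZeroSMulDivisors (𝓞 F) (𝓞 E) := ⟨fun {c x} hcx => by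
    rw [Algebra.smul_def, mul_eq_zero] at hcx
    rcases hcx with hc | hx
    · exact Or.inl (RingOfIntegers.algebraMap.injective F E (by rw [hc, map_zero]))
    · exact Or.inr hx⟩
  have hp0 : w.asIdeal.under (𝓞 F) ≠ ⊥ := Ideal.under_ne_bot (𝓞 F) w.ne_bot
  have h1 : 0 < w.asIdeal.inertiaDeg (𝓞 F) := Ideal.inertiaDeg_pos _ _
  have h2 : (w.asIdeal.under (𝓞 F)).inertiaDeg' w.asIdeal ≤ Module.finrank F E :=
    Ideal.inertiaDeg_le_finrank (𝓞 E) F E w.asIdeal hp0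
  rw [Ideal.inertiaDeg'_eq_inertiaDeg] at h2
  omega

/-- `α ↦ α ^ 1` is the identity on multisets. [folklore] -/
theorem multiset_map_pow_one (α : Multiset ℂ) : α.map (fun a => a ^ 1) = α := by
  simp

end TrivialHullDescentProof

open TrivialHullDescentProof Literature.NumberTheory.Automorphic
  Literature.NumberTheory.GaloisRepresentations in
/-- **`TrivialHullDescent` holds** (stmt-Langlands-28227): Galois-hull descent along a layer of
degree `[L:K] = 1` — transport of `r` along the `K`-isomorphism `K ≅ L`. [folklore] -/
theorem trivialHullDescent_proof :
    Summit.Langlands.Langlands.Theses.GaloisHullLift.TrivialHullDescent := by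
  intro K _ _ n hcpt _hn π _hπ L _ _ _ _hGal hdeg ℓ _ ι r hr H
  classical
  -- (1) `algebraMap K L` is a bijection; `e : K ≃+* L`
  have hbij : Function.Bijective (algebraMap K L) :=
    Module.Free.bijective_algebraMap_of_finrank_eq_one hdeg
  let e : K ≃+* L := RingEquiv.ofBijective (algebraMap K L) hbij
  -- (2) the inverse algebra structure `L → K`; `K/L` is Galois of degree `1`
  letI instLK : Algebra L K := (e.symm : L ≃+* K).toRingHom.toAlgebra
  let eLK : L ≃ₐ[L] K := AlgEquiv.ofRingEquiv (f := (e.symm : L ≃+* K)) (fun _ => rfl)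
  haveI : IsGalois L K := IsGalois.of_algEquiv eLK
  have hdeg' : Module.finrank L K = 1 := by
    rw [← eLK.toLinearEquiv.finrank_eq, Module.finrank_self]
  -- (3) the descended representation
  refine ⟨r.restrictField K, r.isSemisimple_restrictField hr, ?_⟩
  -- (4) the place of `L` above/below a place `v` of `K`
  let wL : HeightOneSpectrum (𝓞 K) → HeightOneSpectrum (𝓞 L) := fun v =>
    ⟨v.asIdeal.under (𝓞 L), inferInstance, Ideal.under_ne_bot (𝓞 L) v.ne_bot⟩
  have hcomp : ∀ x : 𝓞 K, algebraMap (𝓞 L) (𝓞 K) (algebraMap (𝓞 K) (𝓞 L) x) = x := by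
    intro x
    apply RingOfIntegers.coe_injective
    change e.symm (e (x : K)) = (x : K)
    exact e.symm_apply_apply (x : K)
  have hwv : ∀ v : HeightOneSpectrum (𝓞 K), (wL v).asIdeal.under (𝓞 K) = v.asIdeal := by
    intro v
    ext x
    change algebraMap (𝓞 L) (𝓞 K) (algebraMap (𝓞 K) (𝓞 L) x) ∈ v.asIdeal ↔ x ∈ v.asIdeal
    rw [hcomp]
  have hwinj : Function.Injective wL := by
    intro v₁ v₂ h
    have h' : (wL v₁).asIdeal.under (𝓞 K) = (wL v₂).asIdeal.under (𝓞 K) := by rw [h]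
    rw [hwv, hwv] at h'
    exact HeightOneSpectrum.ext h'
  -- (5) residue degrees are `1` on both legs
  have hf₁ : ∀ v : HeightOneSpectrum (𝓞 K), (wL v).asIdeal.inertiaDeg (𝓞 K) = 1 := fun v =>
    inertiaDeg_eq_one_of_finrank_eq_one hdeg (wL v)
  have hf₂ : ∀ v : HeightOneSpectrum (𝓞 K), v.asIdeal.inertiaDeg (𝓞 L) = 1 := fun v =>
    inertiaDeg_eq_one_of_finrank_eq_one hdeg' v
  -- (6) pull the cofinite hypothesis back to the places of `K` and conclude place by place
  filter_upwards [hwinj.tendsto_cofinite.eventually H, π.1.hasSatakeParamAt_cofinite_holds]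
    with v hv hunr
  obtain ⟨α, hα⟩ := hunr
  obtain ⟨hur, hch⟩ := hv v α (hwv v) hα
  rw [hf₁ v, multiset_map_pow_one] at hch
  obtain ⟨hur', hch'⟩ :=
    hasFrobCharpolyAt_restrictField_arithFrobPolyOfSatake (K := L) (L := K) ι r
      (v := wL v) (w := v) rfl hur 1 hch
  rw [hf₂ v, multiset_map_pow_one] at hch'
  exact ⟨α, hα, hur', hch'⟩

end Summit.Langlands.Langlands.Theorems
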